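import Literature.MathematicalPhysics.KineticTheory.HierarchyPruningEstimates
import HarnessLib

/-!
# Time separation of the collision trees (BGSR Proposition 5.5, abstract form, term level)
(Bodineau–Gallagher–Saint-Raymond, Invent. Math. 203 (2016) = arXiv:1305.3397v2, §5.2.2 (the
separated collision times `𝒯_{J,δ}(h)`) and §5.3.2 "Time separation", Proposition 5.5 and its
proof; trunk T-KINETIC, topic MathematicalPhysics/KineticTheory; a layer (N5d₂) of the bottom-up
proof plan of the named fact `bgsr_theorem22` / fact (c) `bodineau_gallagher_saintRaymond_linear`
recorded in `TaggedSphereLinearBoltzmann`, on top of the chain estimates of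
`HierarchyContinuityEstimates` (N3) and the Duhamel algebra of `HierarchyDuhamelBlocks` (N4a).)

BGSR §5.2.2 (p. 18): "As the stability of the good configurations … requires a delay `δ > 0` in
between 2 collisions, we introduce a modified set of collision times
`𝒯_{J,δ}(h) := {T = (t_1, …, t_{J_K-1}) / t_i < t_{i-1} - δ, …}`", and §5.3.2, Proposition 5.5:
*"There is a constant `C` depending only on `β` and `d` such that, as `N` goes to infinity in the
scaling `N ε^{d-1} α⁻¹ ≡ 1`, `‖f_{N,E}^{(1,K)} - f_{N,E,δ}^{(1,K)}‖_{L^∞([0,t] × T^d × ℝ^d)} +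
‖g_{α,E}^{(1,K)} - g_{α,E,δ}^{(1,K)}‖_{L^∞} ≤ A^{(K+2)(K+1)} (C α t)^{A^{K+1}} (δ/t) ‖ρ⁰‖_{L^∞}`"*,
with the printed proof: "the difference involves the integration over two consecutive times such
that `|t_{i+1} - t_i| ≤ δ`. This leads to a contribution `δ t^{J_K-2}/(J_K-2)!` instead of
`t^{J_K-1}/(J_K-1)!` and there are `J_K - 1` possible choices for the collision with a short
time separation. Modifying accordingly the estimates of Lemma 4.2, we get …".

This file formalises the time separation at the level of ONE Duhamel term of an abstract
`HierarchyModel` (both hierarchies), block-locally: in a block of duration `t` the `n` collision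
times `t_1 > ⋯ > t_n` of `Q_{s,s+n}(t)` are required to satisfy `t_i ≤ t_{i-1} - δ` for
`1 ≤ i ≤ n` (`t_0 := t`) and `t_n > δ`, i.e. every collision time is at distance `≥ δ` from the
previous one and from both ends of the block
(`HierarchyModel.sepTerm`; consecutive collisions lying in different blocks of the pruned
expansion are then `2δ`-separated as well, so the nested block structure of N4a is preserved), and
PROVES the printed mechanism:

* `HierarchyModel.abs_sepTerm_le_weighted` — the separated terms obey the chain estimate of
  Lemma 4.2 (`|Q^δ_{s,s+n}(t) G (Z)| ≤ K Λⁿ tⁿ/n! e^{-λ₀ H(Z)}`, same majorant as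
  `abs_duhamelTerm_le_weighted`);
* `HierarchyModel.isNiceT_sepTerm` — they stay in the Lanford class (joint measurability through
  the variable integration bounds), so that the collision operators are additive on them;
* `HierarchyModel.abs_duhamelTerm_sub_sepTerm_le` — **the time-separation error for one term**:
  `|Q_{s,s+n}(t) G (Z) - Q^δ_{s,s+n}(t) G (Z)| ≤ 2δ · n · K Λⁿ t^{n-1}/(n-1)! e^{-λ₀ H(Z)}`
  ("`δ t^{J-2}/(J-2)!` instead of `t^{J-1}/(J-1)!`, `J - 1` choices"; the factor `2` accounts for
  the two ends of the block).

Summing these errors through the blocks of the pruned expansion (the analogue of N4b's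
`abs_blockComp_le` for the difference of the block composites, a telescoping sum over the block
in which the separation is violated) is NOT done here.

## References

* T. Bodineau, I. Gallagher, L. Saint-Raymond, *The Brownian motion as the limit of a
  deterministic system of hard-spheres*, Invent. Math. 203 (2016) 493–553 = arXiv:1305.3397v2,
  §5.2.2 (p. 18), §5.3.2 Proposition 5.5 (pp. 19–20 of the held text).
-/

open MeasureTheory Metric Real Set Filter Function
open scoped Nat
open Literature.Analysis.FluidPDE (Config configEnergy GCState duhamelTerm duhamelTerm_zero
  duhamelTerm_succ)

namespace Literature.MathematicalPhysics.KineticTheory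

noncomputable section

section Kinetic

variable {d : Type*} [Fintype d] {X : Type*} [MeasurableSpace X]

/-! ## Measurability of parametric interval integrals with variable bounds -/

/-- A parametric interval integral `a ↦ ∫_{lo(a)}^{hi(a)} f(a, τ) dτ` with measurable bounds
`lo ≤ hi` and jointly measurable integrand is measurable (Fubini measurability; the fixed-lower-
bound case is `Literature.Analysis.FluidPDE.measurable_intervalIntegral_param`). [folklore] -/
theorem measurable_intervalIntegral_param₂ {α : Type*} [MeasurableSpace α] {f : α × ℝ → ℝ}
    (hf : Measurable f) {lo hi : α → ℝ} (hlo : Measurable lo) (hhi : Measurable hi)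
    (hle : ∀ a, lo a ≤ hi a) : Measurable fun a => ∫ τ in lo a..hi a, f (a, τ) := by
  classical
  have hg : Measurable fun q : α × ℝ => if lo q.1 < q.2 ∧ q.2 ≤ hi q.1 then f q else 0 := by
    refine Measurable.ite ?_ hf measurable_const
    exact (measurableSet_lt (hlo.comp measurable_fst) measurable_snd).inter
      (measurableSet_le measurable_snd (hhi.comp measurable_fst))
  have h := (hg.stronglyMeasurable.integral_prod_right' (ν := (volume : Measure ℝ))).measurable
  have heq : (fun a => ∫ τ in lo a..hi a, f (a, τ)) =
      fun a => ∫ τ, (if lo a < τ ∧ τ ≤ hi a then f (a, τ) else 0) := by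
    funext a
    rw [intervalIntegral.integral_of_le (hle a), ← integral_indicator measurableSet_Ioc]
    congr 1
    funext τ
    simp only [Set.indicator, Set.mem_Ioc]
  rw [heq]
  exact h

namespace HierarchyModel

variable (M : HierarchyModel d X)

/-! ## The `δ`-separated Duhamel terms -/

/-- The `δ`-separated Duhamel terms of a hierarchy model, block-locally: `Q^δ_{s,s}(t) G =
S_s(t) G^{(s)}` and `Q^δ_{s,s+n+1}(t) G = ∫_{δ}^{max(δ, t-δ)} S_s(t-τ) C_s Q^δ_{s+1,s+1+n}(τ) G dτ`
— every collision time is at least `δ` after the next one and at least `δ` away from both ends of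
the time interval (BGSR's `𝒯_{J,δ}(h)` of §5.2.2, imposed inside each block; `max(δ, t-δ)` makes
the integral vanish when `t < 2δ`). For `δ = 0` these are the Duhamel terms.
[cite: BodineauGallagherSaintRaymondInvent2016, §5.2.2, p. 18] -/
def sepTerm (δ : ℝ) : ℕ → (s : ℕ) → ℝ → GCState d X → Config s d X → ℝ
  | 0, s, t, G => M.transport s t (G s)
  | n + 1, s, t, G => fun Z =>
      ∫ τ in δ..max δ (t - δ), M.transport s (t - τ) (M.op s (sepTerm δ n (s + 1) τ G)) Z

/-- The separated term without collision is the transported datum. [folklore] -/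
@[simp]
theorem sepTerm_zero (δ : ℝ) (s : ℕ) (t : ℝ) (G : GCState d X) :
    M.sepTerm δ 0 s t G = M.transport s t (G s) := rfl

/-- The recursion of the separated terms. [folklore] -/
theorem sepTerm_succ (δ : ℝ) (n s : ℕ) (t : ℝ) (G : GCState d X) (Z : Config s d X) :
    M.sepTerm δ (n + 1) s t G Z =
      ∫ τ in δ..max δ (t - δ), M.transport s (t - τ) (M.op s (M.sepTerm δ n (s + 1) τ G)) Z := rfl

/-- For `t < 2δ` a separated term with at least one collision vanishes (no room for a collision
at distance `δ` from both ends). [folklore] -/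
theorem sepTerm_succ_of_lt {δ : ℝ} (n s : ℕ) {t : ℝ} (ht : t < 2 * δ) (G : GCState d X)
    (Z : Config s d X) : M.sepTerm δ (n + 1) s t G Z = 0 := by
  rw [sepTerm_succ, max_eq_left (by linarith), intervalIntegral.integral_same]

/-! ## The chain estimate for the separated terms -/

/-- One collision operator applied to a weighted-bounded density and transported: the pointwise
step of the chain estimates (`|S C g| ≤ Λ K e^{-b₀ H}` if `|g| ≤ K e^{-(b₀+η) H}`, with
`Λ = chainCost λₘ η k_max`, `λₘ ≤ b₀`, level `s ≤ k_max`). [cite: BodineauGallagherSaintRaymondInvent2016, §4.2, proof of Lemma 4.2, pp. 11–12] -/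
theorem abs_transport_op_le {bm η : ℝ} (hbm : 0 < bm) (hη : 0 < η) {kmax s : ℕ} (hs : s ≤ kmax)
    {b₀ : ℝ} (hb₀ : bm ≤ b₀) {K : ℝ} (hK : 0 ≤ K) {g : Config (s + 1) d X → ℝ}
    (hg : ∀ Z', |g Z'| ≤ K * exp (-(b₀ + η) * configEnergy Z')) (u : ℝ) (Z : Config s d X) :
    |M.transport s u (M.op s g) Z| ≤ M.chainCost bm η kmax * K * exp (-b₀ * configEnergy Z) := by
  have hsbm : 0 < sqrt bm := sqrt_pos.2 hbm
  have hb₁ : 0 < b₀ + η := by linarith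
  obtain ⟨Z', hE', hZ'⟩ := M.transport_energy s u (M.op s g) Z
  rw [hZ', ← hE']
  refine (M.op_weighted s g K (b₀ + η) hb₁ hK hg Z').trans ?_
  have hsb : sqrt bm ≤ sqrt (b₀ + η) := sqrt_le_sqrt (by linarith)
  have h1 : (sqrt (b₀ + η) ^ Fintype.card d)⁻¹ ≤ (sqrt bm ^ Fintype.card d)⁻¹ := by
    apply inv_anti₀ (pow_pos hsbm _)
    exact pow_le_pow_left₀ hsbm.le hsb _
  have h2 : (s * (sqrt (b₀ + η))⁻¹ + ∑ i, ‖(Z' i).2‖) * exp (-η * configEnergy Z') ≤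
      kmax * (sqrt bm)⁻¹ + sqrt (kmax / η) := by
    have hmom := sum_norm_mul_exp_neg_mul_configEnergy_le Z' hη
    have hexp1 : exp (-η * configEnergy Z') ≤ 1 := by
      apply exp_le_one_iff.2
      nlinarith [configEnergy_nonneg' Z']
    have hsk' : (s : ℝ) ≤ kmax := by exact_mod_cast hs
    have hinv : (sqrt (b₀ + η))⁻¹ ≤ (sqrt bm)⁻¹ := inv_anti₀ hsbm hsb
    have hsq : sqrt (s / η) ≤ sqrt (kmax / η) := sqrt_le_sqrt (by gcongr)
    rw [add_mul]
    refine add_le_add ?_ (hmom.trans hsq)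
    calc (s : ℝ) * (sqrt (b₀ + η))⁻¹ * exp (-η * configEnergy Z')
        ≤ (s : ℝ) * (sqrt (b₀ + η))⁻¹ * 1 := by gcongr
      _ = (s : ℝ) * (sqrt (b₀ + η))⁻¹ := mul_one _
      _ ≤ kmax * (sqrt bm)⁻¹ := by gcongr
  have hexp : exp (-(b₀ + η) * configEnergy Z') =
      exp (-η * configEnergy Z') * exp (-b₀ * configEnergy Z') := by
    rw [← Real.exp_add]
    congr 1
    ring
  have hC := M.opConst_nonneg
  calc M.opConst * (sqrt (b₀ + η) ^ Fintype.card d)⁻¹ * (s * (sqrt (b₀ + η))⁻¹ + ∑ i, ‖(Z' i).2‖) *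
        (K * exp (-(b₀ + η) * configEnergy Z'))
      = M.opConst * (sqrt (b₀ + η) ^ Fintype.card d)⁻¹ *
          ((s * (sqrt (b₀ + η))⁻¹ + ∑ i, ‖(Z' i).2‖) * exp (-η * configEnergy Z')) *
          (K * exp (-b₀ * configEnergy Z')) := by rw [hexp]; ring
    _ ≤ M.opConst * (sqrt bm ^ Fintype.card d)⁻¹ * (kmax * (sqrt bm)⁻¹ + sqrt (kmax / η)) *
          (K * exp (-b₀ * configEnergy Z')) := by gcongr
    _ = M.chainCost bm η kmax * K * exp (-b₀ * configEnergy Z') := by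
        unfold chainCost; ring

/-- **The chain estimate for the separated terms** (same majorant as for the Duhamel terms,
`abs_duhamelTerm_le_weighted`; the time integrals only shrink): with floor `λₘ`, decrement `η`
per collision operator and at most `k_max + 1` particles, if `|G^{(m)}| ≤ K e^{-(λ₀+nη) H}` at the
top level `m = s + n` then for `t ≥ 0`, `δ ≥ 0`,
`|Q^δ_{s,s+n}(t) G (Z)| ≤ K Λⁿ tⁿ/n! e^{-λ₀ H(Z)}`, `Λ = chainCost λₘ η k_max` (the top level is a
free index `m` to avoid casts, as in N3).
[cite: BodineauGallagherSaintRaymondInvent2016, §4.2 Lemma 4.2 and §5.3.2, pp. 11–12, 19–20] -/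
theorem abs_sepTerm_le_weighted {δ : ℝ} (hδ : 0 ≤ δ) {bm η : ℝ} (hbm : 0 < bm) (hη : 0 < η)
    (kmax : ℕ) (G : GCState d X) :
    ∀ (n s m : ℕ), m = s + n → m ≤ kmax + 1 → ∀ {b₀ : ℝ}, bm ≤ b₀ → ∀ {K : ℝ}, 0 ≤ K →
      (∀ Z : Config m d X, |G m Z| ≤ K * exp (-(b₀ + n * η) * configEnergy Z)) →
      ∀ {t : ℝ}, 0 ≤ t → ∀ Z : Config s d X,
        |M.sepTerm δ n s t G Z| ≤
          K * M.chainCost bm η kmax ^ n * t ^ n / n ! * exp (-b₀ * configEnergy Z) := by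
  set Λ := M.chainCost bm η kmax with hΛ
  have hΛ0 : 0 ≤ Λ := M.chainCost_nonneg bm η kmax
  intro n
  induction n with
  | zero =>
    intro s m hm _ b₀ _ K _ hin t _ Z
    obtain rfl : m = s := by simpa using hm
    rw [sepTerm_zero, M.transport_apply, ← M.configEnergy_flow m (-t) Z]
    simpa using hin (M.flow m (-t) Z)
  | succ n ih =>
    intro s m hm hmk b₀ hb₀ K hK hin t ht Z
    have hs : s ≤ kmax := by omega
    -- the induction hypothesis at level `s + 1`, final weight `b₀ + η`
    have hin' : ∀ Z : Config m d X, |G m Z| ≤ K * exp (-((b₀ + η) + n * η) * configEnergy Z) := by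
      intro Z'
      convert hin Z' using 3
      push_cast
      ring
    have hIH := @ih (s + 1) m (by omega) hmk (b₀ + η) (by linarith) K hK hin'
    -- pointwise bound on the integrand, for `0 ≤ τ ≤ t`
    have hpt : ∀ τ ∈ Icc 0 t, |M.transport s (t - τ) (M.op s (M.sepTerm δ n (s + 1) τ G)) Z| ≤
        Λ * (K * Λ ^ n * τ ^ n / n !) * exp (-b₀ * configEnergy Z) := by
      intro τ hτ
      have hKτ : 0 ≤ K * Λ ^ n * τ ^ n / n ! := by
        have := hτ.1
        positivity
      have hg : ∀ Z' : Config (s + 1) d X, |M.sepTerm δ n (s + 1) τ G Z'| ≤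
          K * Λ ^ n * τ ^ n / n ! * exp (-(b₀ + η) * configEnergy Z') := fun Z' => hIH hτ.1 Z'
      have := M.abs_transport_op_le hbm hη hs hb₀ hKτ hg (t - τ) Z
      simpa only [hΛ, mul_assoc, mul_comm, mul_left_comm] using this
    -- the separated time integral is dominated by the full one
    rw [sepTerm_succ]
    rcases lt_or_ge t (2 * δ) with hlt | hge
    · rw [max_eq_left (by linarith), intervalIntegral.integral_same, abs_zero]
      positivity
    · have hm1 : δ ≤ t - δ := by linarith
      have hm2 : t - δ ≤ t := by linarith
      rw [max_eq_right hm1]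
      have hcont : Continuous fun τ : ℝ => Λ * (K * Λ ^ n * τ ^ n / n !) * exp (-b₀ * configEnergy Z) := by
        fun_prop
      have hle := intervalIntegral.norm_integral_le_of_norm_le hm1
        (Eventually.of_forall fun τ hτ => (Real.norm_eq_abs _).le.trans
          (hpt τ ⟨hδ.trans hτ.1.le, hτ.2.trans hm2⟩))
        (hcont.intervalIntegrable (μ := volume) δ (t - δ))
      rw [Real.norm_eq_abs] at hle
      refine hle.trans ?_
      have hnn : 0 ≤ᵐ[volume.restrict (Ioc 0 t)]
          fun τ : ℝ => Λ * (K * Λ ^ n * τ ^ n / n !) * exp (-b₀ * configEnergy Z) := by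
        refine (ae_restrict_mem measurableSet_Ioc).mono fun τ hτ => ?_
        have := hτ.1.le
        positivity
      refine (intervalIntegral.integral_mono_interval hδ hm1 hm2 hnn
        (hcont.intervalIntegrable (μ := volume) 0 t)).trans (le_of_eq ?_)
      have hfun : (fun τ : ℝ => Λ * (K * Λ ^ n * τ ^ n / n !) * exp (-b₀ * configEnergy Z)) =
          fun τ : ℝ => (Λ * K * Λ ^ n / n ! * exp (-b₀ * configEnergy Z)) * τ ^ n := by
        funext τ
        ring
      rw [hfun, intervalIntegral.integral_const_mul, integral_pow, zero_pow (Nat.succ_ne_zero n),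
        sub_zero, pow_succ, Nat.factorial_succ]
      push_cast
      field_simp
      ring

/-- The chain estimate for the separated terms, in the form used downstream (levels `s + n`). [folklore] -/
theorem abs_sepTerm_le_weighted' {δ : ℝ} (hδ : 0 ≤ δ) {bm η : ℝ} (hbm : 0 < bm) (hη : 0 < η)
    (kmax n s : ℕ) (hk : s + n ≤ kmax + 1) {b₀ : ℝ} (hb₀ : bm ≤ b₀) {K : ℝ} (hK : 0 ≤ K)
    (G : GCState d X)
    (hG : ∀ Z : Config (s + n) d X, |G (s + n) Z| ≤ K * exp (-(b₀ + n * η) * configEnergy Z))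
    {t : ℝ} (ht : 0 ≤ t) (Z : Config s d X) :
    |M.sepTerm δ n s t G Z| ≤
      K * M.chainCost bm η kmax ^ n * t ^ n / n ! * exp (-b₀ * configEnergy Z) :=
  M.abs_sepTerm_le_weighted hδ hbm hη kmax G n s (s + n) rfl hk hb₀ hK hG ht Z

/-! ## The separated terms stay in the Lanford class -/

/-- **Joint measurability and uniform Gaussian bound of the separated terms** on `[0, T]`
(`IsNiceT`): for a nice initial family, `(t, Z) ↦ Q^δ_{s,s+n}(t) G (Z)` is jointly measurable
(parametric interval integral with the measurable bounds `δ`, `max(δ, t - δ)`,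
`measurable_intervalIntegral_param₂`, and N4a's `measurable_duhamelIntegrand`) with a Gaussian
bound uniform on `[0, T]` (from `abs_sepTerm_le_weighted`); hence the collision operators are
additive on the separated terms (`HierarchyModel.op_add`). [folklore] -/
theorem isNiceT_sepTerm {δ : ℝ} (hδ : 0 ≤ δ) {G : GCState d X} (hG : ∀ k, IsNice (G k)) {T : ℝ} :
    ∀ (n s : ℕ), IsNiceT T (fun t Z => M.sepTerm δ n s t G Z) := by
  intro n
  induction n with
  | zero =>
    intro s
    refine ⟨?_, ?_⟩
    · have h1 : Measurable fun p : ℝ × Config s d X => M.flow s (-p.1) p.2 :=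
        (M.measurable_flow s).comp (measurable_fst.neg.prodMk measurable_snd)
      exact (hG s).1.comp h1
    · obtain ⟨K, b, hK, hb, h⟩ := (hG s).2.exists_nonneg
      refine ⟨K, b, hb, fun t _ Z => ?_⟩
      rw [sepTerm_zero, M.transport_apply, ← M.configEnergy_flow s (-t) Z]
      exact h _
  | succ n ih =>
    intro s
    have hu := ih (s + 1)
    refine ⟨?_, ?_⟩
    · -- measurability: parametric interval integral with variable upper bound
      have hI := measurable_duhamelIntegrand M (u := fun τ Z' => M.sepTerm δ n (s + 1) τ G Z')
        hu.measurable
      have hhi : Measurable fun p : ℝ × Config s d X => max δ (p.1 - δ) :=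
        measurable_const.max (measurable_fst.sub measurable_const)
      have hmeas := measurable_intervalIntegral_param₂ hI (lo := fun _ => δ)
        (hi := fun p : ℝ × Config s d X => max δ (p.1 - δ)) measurable_const hhi
        (fun p => le_max_left _ _)
      simpa only [sepTerm_succ] using hmeas
    · -- Gaussian bound uniform on `[0, T]`, from the chain estimate with the bound of `G (s+1+n)`
      obtain ⟨K, b, hK, hb, h⟩ := (hG (s + (n + 1))).2.exists_nonneg
      -- write the weight `b` as `b₀ + (n+1) η` with `b₀ = b/2`, `η = b/(2(n+1))`
      set η : ℝ := b / 2 / (n + 1) with hη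
      have hη0 : 0 < η := by positivity
      have hb₀ : b / 2 + (n + 1 : ℕ) * η = b := by
        rw [hη]; push_cast; field_simp; ring
      have hG' : ∀ Z : Config (s + (n + 1)) d X,
          |G (s + (n + 1)) Z| ≤ K * exp (-(b / 2 + (n + 1 : ℕ) * η) * configEnergy Z) := by
        intro Z; rw [hb₀]; exact h Z
      refine ⟨K * M.chainCost (b / 2) η (s + (n + 1)) ^ (n + 1) * T ^ (n + 1) / (n + 1)!, b / 2,
        half_pos hb, fun t ht Z => ?_⟩
      have hest := M.abs_sepTerm_le_weighted' hδ (half_pos hb) hη0 (s + (n + 1)) (n + 1) s (by omega)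
        le_rfl hK G hG' ht.1 Z
      refine hest.trans ?_
      have hc := M.chainCost_nonneg (b / 2) η (s + (n + 1))
      have hE := configEnergy_nonneg' Z
      have h0t := ht.1
      have htT := ht.2
      gcongr

/-! ## The time-separation error for one Duhamel term -/

/-- **BGSR Proposition 5.5 at the level of one Duhamel term.** Under the hypotheses of the chain
estimate (floor `λₘ`, decrement `η`, at most `k_max + 1` particles, `|G^{(s+n)}| ≤ K e^{-(λ₀+nη)H}`)
and for a nice initial family `G`, for `t ≥ 0` and `0 ≤ δ`:
`|Q_{s,s+n}(t) G (Z) - Q^δ_{s,s+n}(t) G (Z)| ≤ 2δ · n · K Λⁿ t^{n-1}/(n-1)! · e^{-λ₀ H(Z)}`.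
Induction on `n`: the difference at order `n + 1` is the Duhamel integral of
`C (Q_n - Q^δ_n)` over the separated times (additivity of `C` on the Lanford class, induction
hypothesis, chain step) plus the integral of `S C Q^δ_n` over the two removed end intervals
`[0, δ]` and `[t-δ, t]` of total length `≤ 2δ` (pointwise chain bound) — "a contribution
`δ t^{J-2}/(J-2)!` instead of `t^{J-1}/(J-1)!` and there are `J - 1` possible choices".
[cite: BodineauGallagherSaintRaymondInvent2016, §5.3.2 Prop. 5.5, pp. 19–20] -/
theorem abs_duhamelTerm_sub_sepTerm_le {δ : ℝ} (hδ : 0 ≤ δ) {bm η : ℝ} (hbm : 0 < bm) (hη : 0 < η)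
    (kmax : ℕ) {G : GCState d X} (hGn : ∀ k, IsNice (G k)) :
    ∀ (n s m : ℕ), m = s + n → m ≤ kmax + 1 → ∀ {b₀ : ℝ}, bm ≤ b₀ → ∀ {K : ℝ}, 0 ≤ K →
      (∀ Z : Config m d X, |G m Z| ≤ K * exp (-(b₀ + n * η) * configEnergy Z)) →
      ∀ {t : ℝ}, 0 ≤ t → ∀ Z : Config s d X,
        |duhamelTerm M.transport M.op n s t G Z - M.sepTerm δ n s t G Z| ≤
          2 * δ * n * (K * M.chainCost bm η kmax ^ n * t ^ (n - 1) / (n - 1)!) *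
            exp (-b₀ * configEnergy Z) := by
  set Λ := M.chainCost bm η kmax with hΛ
  have hΛ0 : 0 ≤ Λ := M.chainCost_nonneg bm η kmax
  intro n
  induction n with
  | zero =>
    intro s m hm _ b₀ _ K _ _ t _ Z
    simp [duhamelTerm_zero, sepTerm_zero]
  | succ n ih =>
    intro s m hm hmk b₀ hb₀ K hK hin t ht Z
    have hs : s ≤ kmax := by omega
    have hin' : ∀ Z : Config m d X, |G m Z| ≤ K * exp (-((b₀ + η) + n * η) * configEnergy Z) := by
      intro Z'
      convert hin Z' using 3
      push_cast
      ring
    -- bounds one level up: the difference (IH) and the separated term (chain estimate)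
    have hIH := @ih (s + 1) m (by omega) hmk (b₀ + η) (by linarith) K hK hin'
    have hduh := abs_duhamelChain_le_weighted M.transport_energy M.opConst_nonneg M.op_weighted
      (fun n s t => duhamelTerm M.transport M.op n s t G)
      (fun n s t Z => duhamelTerm_succ M.transport M.op n s t G Z) ht hbm hη kmax n (s + 1) m
      (by omega) hmk (b₀ := b₀ + η) (by linarith) hK (fun τ _ Z' => ?duh0)
    case duh0 =>
      rw [duhamelTerm_zero]
      obtain ⟨Z'', hE'', hZ''⟩ := M.transport_energy m τ (G m) Z'
      rw [hZ'', ← hE'']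
      exact hin' Z''
    -- niceness (for additivity of the collision operator)
    have hniceQ : ∀ τ, 0 ≤ τ → IsNice (duhamelTerm M.transport M.op n (s + 1) τ G) :=
      fun τ hτ => isNice_duhamelTerm M hGn n (s + 1) hτ
    have hniceS : ∀ τ ∈ Icc 0 t, IsNice (M.sepTerm δ n (s + 1) τ G) :=
      fun τ hτ => (M.isNiceT_sepTerm hδ hGn n (s + 1)).isNice hτ
    -- the two integrands
    set f₁ : ℝ → ℝ := fun τ => M.transport s (t - τ) (M.op s (duhamelTerm M.transport M.op n (s + 1) τ G)) Z
      with hf₁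
    set f₂ : ℝ → ℝ := fun τ => M.transport s (t - τ) (M.op s (M.sepTerm δ n (s + 1) τ G)) Z with hf₂
    -- pointwise bounds on `[0, t]`
    have hpt₁ : ∀ τ ∈ Icc 0 t, |f₁ τ| ≤ Λ * (K * Λ ^ n * t ^ n / n !) * exp (-b₀ * configEnergy Z) := by
      intro τ hτ
      have hKτ : 0 ≤ K * Λ ^ n * τ ^ n / n ! := by have := hτ.1; positivity
      have hg : ∀ Z' : Config (s + 1) d X, |duhamelTerm M.transport M.op n (s + 1) τ G Z'| ≤
          K * Λ ^ n * τ ^ n / n ! * exp (-(b₀ + η) * configEnergy Z') :=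
        fun Z' => hduh τ ⟨hτ.1, hτ.2⟩ Z'
      have h1 := M.abs_transport_op_le hbm hη hs hb₀ hKτ hg (t - τ) Z
      refine h1.trans ?_
      have hE := configEnergy_nonneg' Z
      have hτt : τ ^ n ≤ t ^ n := pow_le_pow_left₀ hτ.1 hτ.2 n
      calc M.chainCost bm η kmax * (K * Λ ^ n * τ ^ n / n !) * exp (-b₀ * configEnergy Z)
          ≤ M.chainCost bm η kmax * (K * Λ ^ n * t ^ n / n !) * exp (-b₀ * configEnergy Z) := by
            gcongr
        _ = _ := by rw [hΛ]
    have hptD : ∀ τ ∈ Icc 0 t, |f₁ τ - f₂ τ| ≤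
        Λ * (2 * δ * n * (K * Λ ^ n * t ^ (n - 1) / (n - 1)!)) * exp (-b₀ * configEnergy Z) := by
      intro τ hτ
      have hsub : f₁ τ - f₂ τ = M.transport s (t - τ) (M.op s
          (duhamelTerm M.transport M.op n (s + 1) τ G - M.sepTerm δ n (s + 1) τ G)) Z := by
        simp only [hf₁, hf₂, M.transport_apply]
        rw [M.op_sub s (hniceQ τ hτ.1) (hniceS τ hτ), Pi.sub_apply]
      rw [hsub]
      have hKτ : 0 ≤ 2 * δ * n * (K * Λ ^ n * τ ^ (n - 1) / (n - 1)!) := by have := hτ.1; positivity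
      have hg : ∀ Z' : Config (s + 1) d X,
          |(duhamelTerm M.transport M.op n (s + 1) τ G - M.sepTerm δ n (s + 1) τ G) Z'| ≤
            2 * δ * n * (K * Λ ^ n * τ ^ (n - 1) / (n - 1)!) * exp (-(b₀ + η) * configEnergy Z') :=
        fun Z' => by simpa only [Pi.sub_apply] using hIH hτ.1 Z'
      have h1 := M.abs_transport_op_le hbm hη hs hb₀ hKτ hg (t - τ) Z
      refine h1.trans ?_
      have hτt : τ ^ (n - 1) ≤ t ^ (n - 1) := pow_le_pow_left₀ hτ.1 hτ.2 _
      calc M.chainCost bm η kmax * (2 * δ * n * (K * Λ ^ n * τ ^ (n - 1) / (n - 1)!)) *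
            exp (-b₀ * configEnergy Z)
          ≤ M.chainCost bm η kmax * (2 * δ * n * (K * Λ ^ n * t ^ (n - 1) / (n - 1)!)) *
            exp (-b₀ * configEnergy Z) := by gcongr
        _ = _ := by rw [hΛ]
    -- integrability of `f₁`, `f₂` on `[0, t]` (nice families, N4a)
    have hint₁ : IntervalIntegrable f₁ volume 0 t :=
      intervalIntegrable_duhamelStep M (isNiceT_duhamelTerm M hGn n (s + 1)) ⟨ht, le_rfl⟩ Z
    have hint₂ : IntervalIntegrable f₂ volume 0 t :=
      intervalIntegrable_duhamelStep M (M.isNiceT_sepTerm hδ hGn n (s + 1)) ⟨ht, le_rfl⟩ Z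
    rw [duhamelTerm_succ, sepTerm_succ]
    change |(∫ τ in (0 : ℝ)..t, f₁ τ) - ∫ τ in δ..max δ (t - δ), f₂ τ| ≤ _
    set B₁ : ℝ := Λ * (K * Λ ^ n * t ^ n / n !) * exp (-b₀ * configEnergy Z) with hB₁
    have hB₁0 : 0 ≤ B₁ := by positivity
    have hE := configEnergy_nonneg' Z
    -- the two contributions add up to the claimed bound
    have hkey : 2 * δ * B₁ + 2 * δ * n * (K * Λ ^ n * t ^ n / n !) * Λ * exp (-b₀ * configEnergy Z) ≤
        2 * δ * (n + 1 : ℕ) * (K * Λ ^ (n + 1) * t ^ (n + 1 - 1) / (n + 1 - 1)!) *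
          exp (-b₀ * configEnergy Z) := by
      rw [hB₁, show n + 1 - 1 = n from rfl]
      push_cast
      have : 2 * δ * (Λ * (K * Λ ^ n * t ^ n / n !) * exp (-b₀ * configEnergy Z)) +
          2 * δ * n * (K * Λ ^ n * t ^ n / n !) * Λ * exp (-b₀ * configEnergy Z) =
          2 * δ * (n + 1) * (K * Λ ^ (n + 1) * t ^ n / n !) * exp (-b₀ * configEnergy Z) := by
        rw [pow_succ]; ring
      rw [this]
    rcases lt_or_ge t (2 * δ) with hlt | hge
    · -- no separated collision fits: the error is the whole Duhamel integral, of length `t < 2δ`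
      rw [max_eq_left (by linarith), intervalIntegral.integral_same, sub_zero]
      have h1 : ‖∫ τ in (0 : ℝ)..t, f₁ τ‖ ≤ B₁ * |t - 0| := by
        refine intervalIntegral.norm_integral_le_of_norm_le_const fun τ hτ => ?_
        rw [uIoc_of_le ht] at hτ
        rw [Real.norm_eq_abs]
        exact hpt₁ τ ⟨hτ.1.le, hτ.2⟩
      rw [Real.norm_eq_abs, sub_zero, abs_of_nonneg ht] at h1
      refine h1.trans (le_trans ?_ hkey)
      have h2 : B₁ * t ≤ B₁ * (2 * δ) := mul_le_mul_of_nonneg_left hlt.le hB₁0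
      have h3 : 0 ≤ 2 * δ * n * (K * Λ ^ n * t ^ n / n !) * Λ * exp (-b₀ * configEnergy Z) := by
        positivity
      linarith
    · have hm1 : δ ≤ t - δ := by linarith
      have hm2 : t - δ ≤ t := by linarith
      rw [max_eq_right hm1]
      -- restrictions of the integrability to the three sub-intervals
      have hI01 : IntervalIntegrable f₁ volume 0 δ :=
        hint₁.mono_set (by rw [uIcc_of_le hδ, uIcc_of_le ht]; exact Icc_subset_Icc le_rfl (hm1.trans hm2))
      have hI11 : IntervalIntegrable f₁ volume δ (t - δ) :=
        hint₁.mono_set (by rw [uIcc_of_le hm1, uIcc_of_le ht]; exact Icc_subset_Icc hδ hm2)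
      have hI21 : IntervalIntegrable f₁ volume (t - δ) t :=
        hint₁.mono_set (by rw [uIcc_of_le hm2, uIcc_of_le ht]; exact Icc_subset_Icc (hδ.trans hm1) le_rfl)
      have hI12 : IntervalIntegrable f₂ volume δ (t - δ) :=
        hint₂.mono_set (by rw [uIcc_of_le hm1, uIcc_of_le ht]; exact Icc_subset_Icc hδ hm2)
      have hsplit : ∫ τ in (0 : ℝ)..t, f₁ τ =
          (∫ τ in (0 : ℝ)..δ, f₁ τ) + (∫ τ in δ..(t - δ), f₁ τ) + ∫ τ in (t - δ)..t, f₁ τ := by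
        rw [intervalIntegral.integral_add_adjacent_intervals hI01 hI11,
          intervalIntegral.integral_add_adjacent_intervals (hI01.trans hI11) hI21]
      have hsub : (∫ τ in δ..(t - δ), f₁ τ) - ∫ τ in δ..(t - δ), f₂ τ =
          ∫ τ in δ..(t - δ), (f₁ τ - f₂ τ) := (intervalIntegral.integral_sub hI11 hI12).symm
      -- the end intervals
      have hend : ∀ {a b : ℝ}, 0 ≤ a → a ≤ b → b ≤ t → b - a ≤ δ → IntervalIntegrable f₁ volume a b →
          |∫ τ in a..b, f₁ τ| ≤ B₁ * δ := by
        intro a b ha hab hbt hba _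
        have h1 : ‖∫ τ in a..b, f₁ τ‖ ≤ B₁ * |b - a| := by
          refine intervalIntegral.norm_integral_le_of_norm_le_const fun τ hτ => ?_
          rw [uIoc_of_le hab] at hτ
          rw [Real.norm_eq_abs]
          exact hpt₁ τ ⟨ha.trans hτ.1.le, hτ.2.trans hbt⟩
        rw [Real.norm_eq_abs, abs_of_nonneg (sub_nonneg.2 hab)] at h1
        exact h1.trans (mul_le_mul_of_nonneg_left hba hB₁0)
      have hend₁ := hend le_rfl hδ (hm1.trans hm2) (by linarith) hI01
      have hend₂ := hend (hδ.trans hm1) hm2 le_rfl (by linarith) hI21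
      -- the middle interval: the difference one level up
      have hmid : |∫ τ in δ..(t - δ), (f₁ τ - f₂ τ)| ≤
          2 * δ * n * (K * Λ ^ n * t ^ n / n !) * Λ * exp (-b₀ * configEnergy Z) := by
        have hcont : Continuous fun τ : ℝ =>
            Λ * (2 * δ * n * (K * Λ ^ n * τ ^ (n - 1) / (n - 1)!)) * exp (-b₀ * configEnergy Z) := by
          fun_prop
        have hptD' : ∀ τ ∈ Icc 0 t, |f₁ τ - f₂ τ| ≤
            Λ * (2 * δ * n * (K * Λ ^ n * τ ^ (n - 1) / (n - 1)!)) * exp (-b₀ * configEnergy Z) := by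
          intro τ hτ
          have hsub' : f₁ τ - f₂ τ = M.transport s (t - τ) (M.op s
              (duhamelTerm M.transport M.op n (s + 1) τ G - M.sepTerm δ n (s + 1) τ G)) Z := by
            simp only [hf₁, hf₂, M.transport_apply]
            rw [M.op_sub s (hniceQ τ hτ.1) (hniceS τ hτ), Pi.sub_apply]
          rw [hsub']
          have hKτ : 0 ≤ 2 * δ * n * (K * Λ ^ n * τ ^ (n - 1) / (n - 1)!) := by
            have := hτ.1; positivity
          have hg : ∀ Z' : Config (s + 1) d X,
              |(duhamelTerm M.transport M.op n (s + 1) τ G - M.sepTerm δ n (s + 1) τ G) Z'| ≤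
                2 * δ * n * (K * Λ ^ n * τ ^ (n - 1) / (n - 1)!) *
                  exp (-(b₀ + η) * configEnergy Z') :=
            fun Z' => by simpa only [Pi.sub_apply] using hIH hτ.1 Z'
          have h1 := M.abs_transport_op_le hbm hη hs hb₀ hKτ hg (t - τ) Z
          simpa only [hΛ, mul_assoc, mul_comm, mul_left_comm] using h1
        have hle := intervalIntegral.norm_integral_le_of_norm_le hm1
          (Eventually.of_forall fun τ hτ => (Real.norm_eq_abs _).le.trans
            (hptD' τ ⟨hδ.trans hτ.1.le, hτ.2.trans hm2⟩))
          (hcont.intervalIntegrable (μ := volume) δ (t - δ))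
        rw [Real.norm_eq_abs] at hle
        refine hle.trans ?_
        have hnn : 0 ≤ᵐ[volume.restrict (Ioc 0 t)] fun τ : ℝ =>
            Λ * (2 * δ * n * (K * Λ ^ n * τ ^ (n - 1) / (n - 1)!)) * exp (-b₀ * configEnergy Z) := by
          refine (ae_restrict_mem measurableSet_Ioc).mono fun τ hτ => ?_
          have := hτ.1.le
          positivity
        refine (intervalIntegral.integral_mono_interval hδ hm1 hm2 hnn
          (hcont.intervalIntegrable (μ := volume) 0 t)).trans (le_of_eq ?_)
        have hfun : (fun τ : ℝ =>
            Λ * (2 * δ * n * (K * Λ ^ n * τ ^ (n - 1) / (n - 1)!)) * exp (-b₀ * configEnergy Z)) =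
            fun τ : ℝ => (Λ * (2 * δ * n * (K * Λ ^ n / (n - 1)!)) * exp (-b₀ * configEnergy Z)) *
              τ ^ (n - 1) := by
          funext τ
          ring
        rw [hfun, intervalIntegral.integral_const_mul, integral_pow]
        cases n with
        | zero => simp
        | succ k =>
          rw [show k + 1 - 1 = k from rfl, zero_pow (Nat.succ_ne_zero k), sub_zero, Nat.factorial_succ]
          push_cast
          field_simp
      calc |(∫ τ in (0 : ℝ)..t, f₁ τ) - ∫ τ in δ..(t - δ), f₂ τ|
          = |(∫ τ in (0 : ℝ)..δ, f₁ τ) + (∫ τ in (t - δ)..t, f₁ τ) +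
              ∫ τ in δ..(t - δ), (f₁ τ - f₂ τ)| := by
            rw [hsplit, ← hsub]; ring_nf
        _ ≤ |∫ τ in (0 : ℝ)..δ, f₁ τ| + |∫ τ in (t - δ)..t, f₁ τ| +
              |∫ τ in δ..(t - δ), (f₁ τ - f₂ τ)| := abs_add_three _ _ _
        _ ≤ B₁ * δ + B₁ * δ + 2 * δ * n * (K * Λ ^ n * t ^ n / n !) * Λ * exp (-b₀ * configEnergy Z) :=
            add_le_add (add_le_add hend₁ hend₂) hmid
        _ = 2 * δ * B₁ + 2 * δ * n * (K * Λ ^ n * t ^ n / n !) * Λ * exp (-b₀ * configEnergy Z) := by ring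
        _ ≤ _ := hkey

/-- The time-separation error for one term, in the form used downstream (levels `s + n`). [folklore] -/
theorem abs_duhamelTerm_sub_sepTerm_le' {δ : ℝ} (hδ : 0 ≤ δ) {bm η : ℝ} (hbm : 0 < bm) (hη : 0 < η)
    (kmax n s : ℕ) (hk : s + n ≤ kmax + 1) {b₀ : ℝ} (hb₀ : bm ≤ b₀) {K : ℝ} (hK : 0 ≤ K)
    {G : GCState d X} (hGn : ∀ k, IsNice (G k))
    (hG : ∀ Z : Config (s + n) d X, |G (s + n) Z| ≤ K * exp (-(b₀ + n * η) * configEnergy Z))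
    {t : ℝ} (ht : 0 ≤ t) (Z : Config s d X) :
    |duhamelTerm M.transport M.op n s t G Z - M.sepTerm δ n s t G Z| ≤
      2 * δ * n * (K * M.chainCost bm η kmax ^ n * t ^ (n - 1) / (n - 1)!) *
        exp (-b₀ * configEnergy Z) :=
  M.abs_duhamelTerm_sub_sepTerm_le hδ hbm hη kmax hGn n s (s + n) rfl hk hb₀ hK hG ht Z

end HierarchyModel

end Kinetic

end

end Literature.MathematicalPhysics.KineticTheory
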